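import Literature.NumberTheory.Automorphic.ArchTorusOneAngleCurve   -- ★ `eventually_injective_splitCurve` (Rogawski's one-angle curve through a split wall point is regular for small `ψ ≠ 0`)
import Mathlib.Analysis.Calculus.Deriv.Basic
import HarnessLib

/-!
# The JOINT place-by-place induction of the «method of §8.2» for TWO DIFFERENT state families (the endoscopic singular transfer at `∞`,
# Rogawski 1990 Prop. 8.2.1 (a) pp. 118–119, §8.2 pp. 122–124, Lemma 14.5.2 (b) pp. 238–239)

Cell `pub/hodgecm-mathlib`, Track B «K2-LIT», engine K2·E4 (chair K2-lead), socket #11 `sig_K2E4ArchSingularKernel` of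
`Cruxes/H413/Lines/K2_E4_SingularTransferKappaSignSigsArchLimitConstant.lean` (crux H413 = `stmt-HodgeConjecture-24833`); helper brick (3) of the
K2E4-p11 census (pure bookkeeping, no measure theory; lands `--supports stmt-HodgeConjecture-24833`).

WHY.  The kernel half of Prop. 8.2.1 (a) at `∞` — «the archimedean stable orbital integral of `a′` at `γ₀ ⊗ 1` vanishes ⇒ `a^H(γ_H ⊗ 1) = 0` for every
smooth `Δ‴_∞`-pair `(a^H, a′)`» — is assembled exactly like ★ `archDeltaTransfer_apply_center_eq_zero` (Lemma 14.5.2 (c)), except that at the `H`-WALL point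
`γ_H = (e₁•1₂, e₂)` (`e₁ ≠ e₂`) neither side is flat: BOTH sides of the torus identity ★ `sum_integral_pi_eq_inv_mul_finsum_delta_comap_archSingularCurve`
must be taken to the wall ONE PLACE AT A TIME, the `H`-side by Harish-Chandra's rank-one limit formula at the CENTRE of `U(1,1)_w`
(★ `exists_tendsto_deriv_two_sin_smul_integral_integral_insert`, a sum over the flips `ε : W → Bool`), the `G′`-side by the wall formulas of the «method of §8.2»
(★ `exists_tendsto_deriv_sin_mul_sum_sum_integral_pi_update_splitCurve`, ★ `wallCoef_hstep_of_clause`, a sum over the relabellings `ρ : W → S₃` WEIGHTED by the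
κ-signs `K_ρ` of `Δ″_∞`).  The two bookkeeping structures differ (and the κ-weights are not symmetric under `S₃`), so ★ `PlaceInduction.sum_prod_mul_eq_of_step_of_regular_eq`
— two systems of the SAME shape `Σ_ρ I(v ↦ R_v(z_v ∘ ρ_v))` — does not apply.  THIS FILE abstracts one level further: a «system» is just a STATE FAMILY
`A : Finset W → (Π v, Z v) → F` (the state after the places `S` have been taken to the wall, at the regular data `z` of the remaining places) together with its ONE-STEP LAW
«along the curve `γ_w(ψ)` at an unprocessed place `w`, the observable `ψ ↦ G ψ (A S z[w ↦ γ_w ψ])` (print: `2 sin ψ · (…)`) has `ψ`-derivative tending, along a filter `l` at `0`,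
to the next state `A (insert w S) z`».  THEOREM: two state families with the same curve, observable and filter, each obeying its own step law, which AGREE at every regular datum
before any place is processed (`S = ∅`: the torus identity (4.3.1)), agree after all places are processed (`S = univ`: the singular identity).  The proof is the induction of
★ `PlaceInduction` stripped to its logical core: at the step the two observables coincide on the window where the moving coordinate is regular (induction hypothesis at
`z[w ↦ γ_w ψ]`), hence so do their derivatives there (`Filter.EventuallyEq.deriv_eq`) and the two limits (`tendsto_nhds_unique_of_eventuallyEq`).

* §1 **`eq_of_step_of_regular_eq`** — the abstract joint induction (places `W`, per-place data types `Z v` with regularity predicates, states in a real normed space `F`,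
  observable `G : ℝ → F → F`, any filter `l` with `l.NeBot`; the curve is required to be LOCALLY regular `l`-eventually).
* §2 **`eq_of_step_of_regular_eq_splitCurve`** — the instance the singular transfer uses: `Z v = (Fin 3 → S¹)` (torus angles), regularity = injectivity, the curve
  `γ_w(ψ) = (z⁰_{w,0} e^{iψ}, z⁰_{w,1}, z⁰_{w,0} e^{−iψ})` through a split wall point `z⁰_w` (`z⁰_{w,0} = z⁰_{w,2} ≠ z⁰_{w,1}`), any `l ≤ 𝓝[≠] 0` (both `ψ → 0±` one-sided
  and the punctured two-sided filters of the tree's limit formulas); `eventually_eventually_nhds_of_eventually_nhdsNE` is the small topological fact feeding §1's local regularity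
  from ★ `eventually_injective_splitCurve`.
HONEST LABEL: HC_CM is proved only modulo the 7 printed citations (2 remaining named inputs: hLiu418 = stmt-HodgeConjecture-24832, h413 = stmt-HodgeConjecture-24833) until rung 0
closes; this file is bookkeeping and pays nothing by itself.

## References
* [Rogawski1990] J. D. Rogawski, *Automorphic Representations of Unitary Groups in Three Variables*, Ann. of Math. Stud. 123 (1990): Prop. 8.2.1 (a) pp. 118–119 (the limit
  formulas for `H` and `H′` applied to both sides of (8.2.1)), §8.2 pp. 122–124 («the same argument … place by place»), §14.5 Lemma 14.5.2 (b) pp. 238–239.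
* [Varadarajan1989] V. S. Varadarajan, *An Introduction to Harmonic Analysis on Semisimple Lie Groups* (1989), §6.4 Thm 22.
-/

set_option autoImplicit false
set_option linter.dupNamespace false  -- the cell's namespace convention `Summit.HodgeConjecture.HodgeConjecture.Cruxes.H413.<File>` repeats the summit = problem name

noncomputable section

open Filter Topology Function Set

namespace Summit.HodgeConjecture.HodgeConjecture.Cruxes.H413.K2E4ArchSingularKernelPlaceInduction

/-! ## §1 The abstract joint induction over the places -/

section Abstract

variable {W : Type*} [Fintype W] [DecidableEq W] {Z : W → Type*}
  {F : Type*} [NormedAddCommGroup F] [NormedSpace ℝ F]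

/-- **THE JOINT PLACE-BY-PLACE INDUCTION (abstract form).**  Places `W`; per-place data `Z v` with a regularity predicate `Reg v`; two STATE FAMILIES
`A B : Finset W → (Π v, Z v) → F` («state after the places in `S` were taken to the wall, at the data `z` of the other places»); a curve `γ_w : ℝ → Z w` at every place,
`l`-eventually LOCALLY regular (`hγ`); an observable `G : ℝ → F → F` (print's `ψ ↦ 2 sin ψ · x`) and a filter `l ≠ ⊥` on `ℝ` (print's `ψ → 0+`).  Suppose each family obeys
ITS OWN one-step law — for `w ∉ S` and `z` regular off `insert w S`, `∂_ψ G ψ (A S z[w ↦ γ_w ψ]) ⟶_l A (insert w S) z` (`hA`), likewise `hB` — and the two families agree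
before any place is processed, at every regular `z` (`hreg`, the torus identity).  THEN they agree after all places are processed: `A univ z = B univ z` for every `z`.
Induction on `S`; at the step the two observables agree on the `l`-window where `γ_w ψ` is regular (induction hypothesis at `z[w ↦ γ_w ψ]`), so their derivatives agree
there and the two `l`-limits coincide. [cite: Rogawski1990, §8.2 pp. 122–124; Prop. 8.2.1 (a) p. 119] [cite: Varadarajan1989, §6.4 Thm 22] -/
theorem eq_of_step_of_regular_eq (Reg : ∀ v : W, Z v → Prop) (A B : Finset W → (∀ v, Z v) → F) (γ : ∀ w : W, ℝ → Z w)
    (G : ℝ → F → F) (l : Filter ℝ) [l.NeBot]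
    (hγ : ∀ w, ∀ᶠ ψ in l, ∀ᶠ ψ' in 𝓝 ψ, Reg w (γ w ψ'))
    (hreg : ∀ z : ∀ v, Z v, (∀ v, Reg v (z v)) → A ∅ z = B ∅ z)
    (hA : ∀ (S : Finset W) (w : W), w ∉ S → ∀ z : ∀ v, Z v, (∀ v, v ∉ S → v ≠ w → Reg v (z v)) →
      Tendsto (fun ψ : ℝ => deriv (fun ψ : ℝ => G ψ (A S (Function.update z w (γ w ψ)))) ψ) l (𝓝 (A (insert w S) z)))
    (hB : ∀ (S : Finset W) (w : W), w ∉ S → ∀ z : ∀ v, Z v, (∀ v, v ∉ S → v ≠ w → Reg v (z v)) →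
      Tendsto (fun ψ : ℝ => deriv (fun ψ : ℝ => G ψ (B S (Function.update z w (γ w ψ)))) ψ) l (𝓝 (B (insert w S) z))) :
    ∀ z : ∀ v, Z v, A Finset.univ z = B Finset.univ z := by
  classical
  -- the claim for a processed set `S`: the `S`-states agree at every datum regular off `S`
  suffices hS : ∀ (S : Finset W) (z : ∀ v, Z v), (∀ v, v ∉ S → Reg v (z v)) → A S z = B S z from
    fun z => hS Finset.univ z fun v hv => absurd (Finset.mem_univ v) hv
  intro S
  induction S using Finset.induction_on with
  | empty =>
    intro z hz
    exact hreg z fun v => hz v (Finset.notMem_empty v)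
  | @insert w S hw ih =>
    intro z hz
    have hz' : ∀ v, v ∉ S → v ≠ w → Reg v (z v) := fun v hvS hvw =>
      hz v (by simp only [Finset.mem_insert, hvw, hvS, or_self, not_false_eq_true])
    -- the two observables agree near every point of the regularity window (IH at `z[w ↦ γ_w ψ']`), hence so do their derivatives
    have hev : (fun ψ : ℝ => deriv (fun ψ : ℝ => G ψ (A S (Function.update z w (γ w ψ)))) ψ) =ᶠ[l]
        fun ψ : ℝ => deriv (fun ψ : ℝ => G ψ (B S (Function.update z w (γ w ψ)))) ψ := by
      filter_upwards [hγ w] with ψ hψ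
      refine Filter.EventuallyEq.deriv_eq ?_
      filter_upwards [hψ] with ψ' hψ'
      have hzψ : ∀ v, v ∉ S → Reg v (Function.update z w (γ w ψ') v) := by
        intro v hv
        by_cases hvw : v = w
        · subst hvw
          rw [Function.update_self]
          exact hψ'
        · rw [Function.update_of_ne hvw]
          exact hz' v hv hvw
      show G ψ' (A S (Function.update z w (γ w ψ'))) = G ψ' (B S (Function.update z w (γ w ψ')))
      rw [ih (Function.update z w (γ w ψ')) hzψ]
    exact tendsto_nhds_unique_of_eventuallyEq (hA S w hw z hz') (hB S w hw z hz') hev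

end Abstract

/-! ## §2 The instance on the torus angles with Rogawski's one-angle curve through a split wall point -/

section SplitCurve

variable {W : Type*} [Fintype W] [DecidableEq W]
  {F : Type*} [NormedAddCommGroup F] [NormedSpace ℝ F]

/-- A property holding on a punctured neighbourhood of `a` holds, at every point of a (smaller) punctured neighbourhood, on a whole neighbourhood of that point
(the punctured neighbourhood filter is generated by open sets not containing `a`). [folklore] -/
theorem eventually_eventually_nhds_of_eventually_nhdsNE {p : ℝ → Prop} {a : ℝ} (h : ∀ᶠ x in 𝓝[≠] a, p x) :
    ∀ᶠ x in 𝓝[≠] a, ∀ᶠ y in 𝓝 x, p y := by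
  rw [eventually_nhdsWithin_iff] at h ⊢
  filter_upwards [h.eventually_nhds] with x hx hxa
  filter_upwards [hx, isOpen_ne.mem_nhds hxa] with y hy hya
  exact hy hya

/-- **THE JOINT PLACE-BY-PLACE INDUCTION ALONG ROGAWSKI'S CURVE.**  Data `z : W → Fin 3 → S¹` (torus angles at the complex places), regularity = injectivity (pairwise distinct
angles), the wall point `z⁰` (`z⁰_{w,0} = z⁰_{w,2} ≠ z⁰_{w,1}` at every place) and the one-angle curve `γ_w(ψ)_j = z⁰_{w,j} e^{i(1,0,−1)_j ψ}` through it (regular for small `ψ ≠ 0`,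
★ `eventually_injective_splitCurve`), any filter `l ≤ 𝓝[≠] 0`, `l ≠ ⊥` (`𝓝[>] 0` for the wall packages, `𝓝[≠] 0` for the two-sided limit formulas).  Two state families with
their own one-step laws along this curve (`hA`, `hB`) that agree at every regular `z` before any place is processed agree after all places are processed.  This is the
frame in which the `H`-side (flips `ε : W → Bool`, rank-one limit formula at the centre of `U(1,1)_w`) and the `G′`-side (κ-weighted relabellings `ρ : W → S₃`, compact ∕ noncompact
wall formulas) of the endoscopic singular transfer are compared. [cite: Rogawski1990, Prop. 8.2.1 (a) pp. 118–119; §8.2 pp. 122–124; §14.5 Lemma 14.5.2 (b) pp. 238–239]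
[cite: Varadarajan1989, §6.4 Thm 22] -/
theorem eq_of_step_of_regular_eq_splitCurve (A B : Finset W → (W → Fin 3 → Circle) → F) (G : ℝ → F → F)
    (z0 : W → Fin 3 → Circle) (hwall : ∀ w, z0 w 0 = z0 w 2 ∧ z0 w 0 ≠ z0 w 1)
    (l : Filter ℝ) [l.NeBot] (hl : l ≤ 𝓝[≠] 0)
    (hreg : ∀ z : W → Fin 3 → Circle, (∀ v, Function.Injective (z v)) → A ∅ z = B ∅ z)
    (hA : ∀ (S : Finset W) (w : W), w ∉ S → ∀ z : W → Fin 3 → Circle, (∀ v, v ∉ S → v ≠ w → Function.Injective (z v)) →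
      Tendsto (fun ψ : ℝ => deriv (fun ψ : ℝ => G ψ (A S (Function.update z w fun j => z0 w j * Circle.exp (![(1 : ℝ), 0, -1] j * ψ)))) ψ) l
        (𝓝 (A (insert w S) z)))
    (hB : ∀ (S : Finset W) (w : W), w ∉ S → ∀ z : W → Fin 3 → Circle, (∀ v, v ∉ S → v ≠ w → Function.Injective (z v)) →
      Tendsto (fun ψ : ℝ => deriv (fun ψ : ℝ => G ψ (B S (Function.update z w fun j => z0 w j * Circle.exp (![(1 : ℝ), 0, -1] j * ψ)))) ψ) l
        (𝓝 (B (insert w S) z))) :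
    ∀ z : W → Fin 3 → Circle, A Finset.univ z = B Finset.univ z :=
  eq_of_step_of_regular_eq (Z := fun _ : W => Fin 3 → Circle) (fun _ => Function.Injective) A B
    (fun w ψ j => z0 w j * Circle.exp (![(1 : ℝ), 0, -1] j * ψ)) G l
    (fun w => (eventually_eventually_nhds_of_eventually_nhdsNE
      (Literature.NumberTheory.Automorphic.eventually_injective_splitCurve (z0 w) (hwall w).1 (hwall w).2)).filter_mono hl)
    hreg hA hB

end SplitCurve

end Summit.HodgeConjecture.HodgeConjecture.Cruxes.H413.K2E4ArchSingularKernelPlaceInduction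

end
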